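import Summits.ValiantsHypothesis.ValiantsHypothesis.Theorems.KPlusLogSqLawTropicalBTightnessThreshold
import Summits.ValiantsHypothesis.ValiantsHypothesis.Theorems.KPlusLogSqLawTropicalBNormalForm

/-!
# Route «KPlusLogSqLaw», crux `TropicalB` (stmt-ValiantsHypothesis-19771) — counting-tightness descends to EVERY sub-alphabet of a DESIGN:
# deleting an arbitrary class `l` from a counting-tight chain leaves a counting-tight chain of the restricted design

HONEST FRAMING.  Small sequel of `…TropicalBTightnessThreshold` (seat val-sym-trop-p4 g12, cell `pub-symmetroid`, 2026-08-28;
`--supports stmt-ValiantsHypothesis-19771 --as helper`).  `Tightness.exists_tight_chain_delete` deletes the class `0`; composing with the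
tree's class relabelling (`isDominant_relabelClasses`, …TropicalBNormalForm, val-sym-trop-p3) deletes ANY class, so the descent law holds at
the level of ONE design and all its sub-alphabets (iterate): a counting-tight design of format `(m, K)` restricts to counting-tight designs on
each of its `C(K, j)` sub-alphabets of size `j ≥ 2` — a necessary condition on the exponent ORDER TYPE of a tight cell (every induced order type
of a sub-alphabet must be a tight order type of the smaller format; cf. the `(3,4)` classification of val-sym-trop-p5 g12: 46 tight / 34
non-tight order types).  Census bookkeeping only; nothing here bears on `TropicalB` in its window, `WeakLifting`, DoorA26 / DoorA34,
`MatrixDescartes` (stmt-ValiantsHypothesis-18050) or VP ≠ VNP.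

* `chain_relabelClasses` — a chain of unique optima stays one (same slopes, same permutations, distinct consecutive terms) after relabelling
  the classes by a permutation `π` of `Fin K` (design `(d ∘ π, v ∘ π, ε ∘ π)`, class maps `π⁻¹ ∘ μ`).
* `exists_tight_chain_delete_class` — **for every class `l : Fin (K+2)`**: a counting-tight unsigned chain of a format-`(m, K+2)` design yields a
  counting-tight unsigned chain (`multichoose (K+1) m` terms) of the design restricted to the classes `≠ l`, indexed by `Fin (K+1)` through
  `j ↦ swap 0 l (succ j)`.
[this file; bookkeeping over the two cited tree lemmas]
-/

set_option linter.dupNamespace false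
set_option autoImplicit false

namespace Summit.ValiantsHypothesis.ValiantsHypothesis.Theorems.KPlusLogSqLaw

open Summit.ValiantsHypothesis.ValiantsHypothesis.Theorems.MatrixDescartes.Negative
open Summit.ValiantsHypothesis.ValiantsHypothesis.Theorems.LacunarySymmetroidMatrixDescartes
open Summit.ValiantsHypothesis.ValiantsHypothesis.Theorems.LacunarySymmetroidMatrixDescartes.TropicalCensus
open scoped BigOperators
open Finset

namespace Tightness

variable {m K : ℕ}

/-- Relabelling the classes of a design by a permutation `π` carries every unsigned chain of unique optima to one of the relabelled
design (class maps `π⁻¹ ∘ μ`), with the same slopes and distinct consecutive terms. [bookkeeping over `isDominant_relabelClasses`] -/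
theorem chain_relabelClasses (π : Equiv.Perm (Fin K)) (d : Fin K → ℕ) (v ε : Fin m → Fin m → Fin K → ℤ) {n : ℕ}
    (θ : Fin (n + 1) → ℤ) (p : Fin (n + 1) → Equiv.Perm (Fin m) × (Fin m → Fin K))
    (hdom : ∀ k, IsDominant d v ε (θ k) (p k)) (hne : ∀ k : Fin n, p k.castSucc ≠ p k.succ) :
    (∀ k, IsDominant (d ∘ π) (fun a b l => v a b (π l)) (fun a b l => ε a b (π l)) (θ k) ((p k).1, π.symm ∘ (p k).2)) ∧
      (∀ k : Fin n, ((p k.castSucc).1, π.symm ∘ (p k.castSucc).2) ≠ ((p k.succ).1, π.symm ∘ (p k.succ).2)) := by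
  refine ⟨fun k => isDominant_relabelClasses π d v ε (θ k) (p k).1 (p k).2 (hdom k), fun k heq => hne k ?_⟩
  obtain ⟨h1, h2⟩ := Prod.mk.inj heq
  refine Prod.ext h1 (funext fun i => ?_)
  have := congrFun h2 i
  simpa using this

/-- **Counting-tightness descends to every sub-alphabet.**  Let `p₀, …, pₙ` be unique optima of a design of format `(m, K+2)` at strictly
increasing slopes, consecutive terms distinct, counting-tight (`multichoose (K+2) m ≤ n + 1`), and let `l` be ANY class.  Then the design
restricted to the classes `≠ l` — re-indexed by `Fin (K+1)` through `j ↦ swap 0 l (succ j)` — has an unsigned chain of unique optima at strictly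
increasing slopes with distinct consecutive terms and `multichoose (K+1) m` terms (counting-tight again). [this file] -/
theorem exists_tight_chain_delete_class {n : ℕ} (d : Fin (K + 2) → ℕ) (v ε : Fin m → Fin m → Fin (K + 2) → ℤ)
    (θ : Fin (n + 1) → ℤ) (p : Fin (n + 1) → Equiv.Perm (Fin m) × (Fin m → Fin (K + 2)))
    (hθ : StrictMono θ) (hdom : ∀ k, IsDominant d v ε (θ k) (p k)) (hne : ∀ k : Fin n, p k.castSucc ≠ p k.succ)
    (htight : Nat.multichoose (K + 2) m ≤ n + 1) (l : Fin (K + 2)) :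
    ∃ (n' : ℕ) (θ' : Fin (n' + 1) → ℤ) (p' : Fin (n' + 1) → Equiv.Perm (Fin m) × (Fin m → Fin (K + 1))),
      StrictMono θ' ∧
      (∀ k, IsDominant (fun j => d (Equiv.swap 0 l j.succ)) (fun a b j => v a b (Equiv.swap 0 l j.succ))
        (fun a b j => ε a b (Equiv.swap 0 l j.succ)) (θ' k) (p' k)) ∧
      (∀ k : Fin n', p' k.castSucc ≠ p' k.succ) ∧
      Nat.multichoose (K + 1) m ≤ n' + 1 := by
  set π : Equiv.Perm (Fin (K + 2)) := Equiv.swap 0 l with hπ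
  obtain ⟨hdom', hne'⟩ := chain_relabelClasses π d v ε θ p hdom hne
  exact exists_tight_chain_delete (d ∘ π) (fun a b j => v a b (π j)) (fun a b j => ε a b (π j)) θ
    (fun k => ((p k).1, π.symm ∘ (p k).2)) hθ hdom' hne' htight

/-! ## Appended: the exponent-level form (non-tightness of a restricted exponent vector lifts) -/

/-- **Non-tightness lifts from a sub-alphabet, at FIXED exponents.**  If the exponent vector restricted to the classes `≠ l` (indexed through
`j ↦ swap 0 l (succ j)`) admits no counting-tight design — `DesignRowD … (multichoose (K+1) m − 2)` for ALL valuations and supports — then the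
full exponent vector `d` admits none either (`m ≥ 1`, `K ≥ 1`; at `K = 0` the statement fails: `(m,2)` is tight while `(m,1)` trivially is not).  This is the form in which ORDER-TYPE LAWS of a smaller alphabet (e.g. the `(3,4)` laws
`designRowD_three_four_18_*` of val-sym-trop-p5 g12) become non-tightness laws of every format `(m, K+2)` whose exponents restrict into their
regions. [this file] -/
theorem designRowD_notTight_of_delete (hm : 1 ≤ m) (hK : 1 ≤ K) (d : Fin (K + 2) → ℕ) (l : Fin (K + 2))
    (h : ∀ v' ε' : Fin m → Fin m → Fin (K + 1) → ℤ,
      DesignRowD (fun j => d (Equiv.swap 0 l j.succ)) v' ε' (Nat.multichoose (K + 1) m - 2))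
    (v ε : Fin m → Fin m → Fin (K + 2) → ℤ) : DesignRowD d v ε (Nat.multichoose (K + 2) m - 2) := by
  intro n θ p hθ hdom hne
  by_contra hlt
  have htight : Nat.multichoose (K + 2) m ≤ n + 1 := by omega
  obtain ⟨n', θ', p', hθ', hdom', hne', htight'⟩ := exists_tight_chain_delete_class d v ε θ p hθ hdom hne htight l
  have hle := h _ _ n' θ' p' hθ' hdom' hne'
  -- `multichoose (K+1) m ≥ m + 1 ≥ 2`, so `n' ≤ N − 2` contradicts `N ≤ n' + 1`
  have hN : m + 1 ≤ Nat.multichoose (K + 1) m := by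
    have h2 : Nat.multichoose 2 m ≤ Nat.multichoose (K + 1) m := by
      rw [Nat.multichoose_eq, Nat.multichoose_eq]
      exact Nat.choose_le_choose m (by omega)
    rw [Nat.multichoose_two] at h2
    exact h2
  omega

end Tightness

end Summit.ValiantsHypothesis.ValiantsHypothesis.Theorems.KPlusLogSqLaw
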